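import Mathlib
import Literature.Probability.LatticeModels.GKSInequalities
import Summits.CriticalPhenomena.Ising3DConformalLimit.Theses.PrecisionLaplacian
import Summits.CriticalPhenomena.Ising3DConformalLimit.Theorems.PrecisionLaplacianInverseMFerromagnetEntryNonposOfPcov
import Summits.CriticalPhenomena.Ising3DConformalLimit.Theorems.PrecisionLaplacianInverseMFerromagnetImNonadjOfLaw2Aux
import Summits.CriticalPhenomena.Ising3DConformalLimit.Theorems.PrecisionLaplacianInverseMFerromagnetImDeg3OfNonadj
import Summits.CriticalPhenomena.Ising3DConformalLimit.Theorems.PrecisionLaplacianInverseMFerromagnetImOfImDeg3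
import Summits.CriticalPhenomena.Ising3DConformalLimit.Theorems.PrecisionLaplacianInverseMFerromagnetRowDegLeTwo
import Summits.CriticalPhenomena.Ising3DConformalLimit.Theorems.PrecisionLaplacianMoebiusLimitOfTwoPointLawAmpLebTriangleOfInverseMAux
import Summits.CriticalPhenomena.Ising3DConformalLimit.Theorems.PrecisionLaplacianMoebiusLimitOfTwoPointLawAmpLebImNonadjAux
import HarnessLib

/-!
# Crux `PrecisionLaplacian.MoebiusLimitOfTwoPointLaw` (stmt-CriticalPhenomena-4801), line `Sketch` —
# stub `stub_imNonadj_of_amputatedLebowitz` (E1: VP¹ ⇒ IM at non-adjacent pairs with one endpoint of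
# degree ≤ 3) and its corollary `stub_inverseM_of_amputatedLebowitz` (VP¹ ⇒ the crux `InverseMFerromagnet`)

THEOREM-ONLY file (no definitions).  VP¹ ("amputated Lebowitz") is the lattice statement
`∑ₐ (Σ⁻¹)_{z a} (−U₄(a; x₂,x₃,x₄)) ≥ 0` for every zero-field pair ferromagnet `μ = gksExpect univ K C`
(`K ≥ 0`, `|C i| = 2`), `Σ = (⟨σ_pσ_q⟩)`.  IM is the crux `PrecisionLaplacian.InverseMFerromagnet`
(stmt-CriticalPhenomena-4798): `(Σ⁻¹)_{xy} ≤ 0` for `x ≠ y`.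

Proof of E1.  Let `x ≠ y` be non-adjacent and let `y` lie in at most three bonds.  By S1
(`stub_entry_nonpos_of_pcov`) it suffices to show `PCov(x,y|S) ≥ 0`, `S = univ ∖ {x,y}`.  If `y` is
free this is `0`.  Otherwise write the local field `h_y = ∑ⱼ bⱼσ_{wⱼ}` (`c2_site`, `wⱼ ∉ {x,y}`), so
that `Σ_{qy} = ⟨tanh(h_y) σ_q⟩ =: v(q)` (`c2_integrate`) and
`tanh h_y = ∑ βⱼ σ_{wⱼ} + κ σ_{w₀}σ_{w₁}σ_{w₂}`, `κ ≤ 0` (`c2_three`).  In the star–triangle decimation `ν`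
of `y` (`e1_decimate`; a pair ferromagnet on `Fin n` with `y` free and the same `σ_y`-free
expectations) `v = ∑ βⱼ N_{· wⱼ} + κ u`, `u(a) = ⟨σ_aσ_{w₀}σ_{w₁}σ_{w₂}⟩_ν`, `N = Σ_ν`.  The one-point Schur
identity (`ghost_schur_row`, on the principal submatrix `N'` of `N` on `univ ∖ {y}`) gives
`PCov = s · (N'⁻¹v')_x = s κ (N'⁻¹u')_x` (`s > 0`, the columns `wⱼ ≠ x` drop), and
`(N'⁻¹u')_x = (N⁻¹u)_x` (`e1_solve_free_row`, the row `y` of `N` being free) is `≤ 0` by VP¹ for `ν` at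
`(x; w₀,w₁,w₂)` (`Σ_ν⁻¹Σ_ν = 1` kills the Wick columns).  Degenerate cubics (`wⱼ` not distinct) make
`v` a combination of columns and `PCov = 0`.  The corollary feeds E1 into the landed bridges C3
`stub_row_deg_le_two`, C4 `stub_imDeg3_of_nonadj`, C5 `stub_im_of_imDeg3` of the 4798 chain.
-/

namespace Summit.CriticalPhenomena.Ising3DConformalLimit.PrecisionLaplacianMoebiusLimitOfTwoPointLaw

open Literature.Probability.LatticeModels Finset Matrix
open Summit.CriticalPhenomena.Ising3DConformalLimit.Cruxes.InverseMFerromagnet.PartialCovarianceLadder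
  (c2_integrate c2_site c2_three c2_free c2_cube_degen schur_posDef stub_entry_nonpos_of_pcov
    pcm2im_spinAt_flip_ne pcm2im_gksExpect_add pcm2im_gksExpect_const_mul
    stub_imDeg3_of_nonadj stub_im_of_imDeg3 stub_row_deg_le_two)

/-- **The Schur core of E1 (pure linear algebra).** Let `A` be positive definite on `Fin n`, `x ≠ y`,
`S = univ ∖ {x,y}`, let `G` agree with `A` off the row/column `y`, and let the vector `v` be, off `y`,
a combination of four columns `w₀,w₁,w₂,t ≠ x` of `A` (all `≠ y`) plus `κ r`.  If
`κ · ((A')⁻¹ r')_x ≥ 0` for the principal submatrix `A'` of `A` on `univ ∖ {y}`, then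
`v_x − ∑_{p,q ∈ S} G_{xp} ((G_SS)⁻¹)_{pq} v_q ≥ 0` (it equals `s κ (A'⁻¹r')_x` with the one-point Schur
complement `s > 0`, `ghost_schur_row`, `ghost_schur_pos`). [folklore] -/
theorem e1_core {n : ℕ} (A : Matrix (Fin n) (Fin n) ℝ) (hA : A.PosDef) (x y : Fin n) (hxy : x ≠ y)
    (hxT : x ∈ Finset.univ.erase y) (S : Finset (Fin n)) (hS : S = (Finset.univ.erase x).erase y)
    (G : Matrix (Fin n) (Fin n) ℝ) (hGA : ∀ p q, p ≠ y → q ≠ y → G p q = A p q)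
    (v r : Fin n → ℝ) (w : Fin 3 → Fin n) (t : Fin n) (hwy : ∀ j, w j ≠ y) (hwx : ∀ j, w j ≠ x)
    (hty : t ≠ y) (htx : t ≠ x) (b₀ b₁ b₂ b₃ κ : ℝ)
    (hv : ∀ a, a ≠ y → v a = b₀ * A a (w 0) + b₁ * A a (w 1) + b₂ * A a (w 2) + b₃ * A a t + κ * r a)
    (hsign : 0 ≤ κ * ((A.submatrix (Subtype.val : ↥(Finset.univ.erase y) → Fin n)
      (Subtype.val : ↥(Finset.univ.erase y) → Fin n))⁻¹.mulVec (fun p => r p.1)) ⟨x, hxT⟩) :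
    0 ≤ v x - ∑ p : ↥S, ∑ q : ↥S,
      G x p.1 * (G.submatrix (Subtype.val : ↥S → Fin n) (Subtype.val : ↥S → Fin n))⁻¹ p q * v q.1 := by
  classical
  set T : Finset (Fin n) := Finset.univ.erase y with hT
  set z : ↥T := ⟨x, hxT⟩ with hz
  set A' : Matrix ↥T ↥T ℝ := A.submatrix (Subtype.val : ↥T → Fin n) (Subtype.val : ↥T → Fin n)
    with hA'
  have hA'pd : A'.PosDef := hA.submatrix Subtype.val_injective
  have hTy : ∀ p : ↥T, p.1 ≠ y := fun p => (Finset.mem_erase.1 p.2).1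
  have hS1 : ∀ p : ↥S, p.1 ≠ x ∧ p.1 ≠ y := fun p => by
    have h : p.1 ∈ (Finset.univ.erase x).erase y := by rw [← hS]; exact p.2
    rw [Finset.mem_erase, Finset.mem_erase] at h
    exact ⟨h.2.1, h.1⟩
  -- the enumeration `gS : ↥S → ↥T` of `T ∖ {z}`
  obtain ⟨gS, hgS⟩ : ∃ gS : ↥S → ↥T, ∀ p, (gS p).1 = p.1 :=
    ⟨fun p => ⟨p.1, Finset.mem_erase.2 ⟨(hS1 p).2, Finset.mem_univ _⟩⟩, fun _ => rfl⟩
  have hgSinj : Function.Injective gS := fun p q h =>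
    Subtype.ext (by rw [← hgS p, ← hgS q, h])
  have hgSz : ∀ p, gS p ≠ z := fun p h => (hS1 p).1 (by rw [← hgS p, h])
  have hgSsurj : ∀ a : ↥T, a ≠ z → ∃ p, gS p = a := fun a ha => by
    have hax : a.1 ≠ x := fun h => ha (Subtype.ext h)
    have haS : a.1 ∈ S := by
      rw [hS, Finset.mem_erase, Finset.mem_erase]
      exact ⟨hTy a, hax, Finset.mem_univ _⟩
    exact ⟨⟨a.1, haS⟩, Subtype.ext (hgS _)⟩
  have hrow := ghost_schur_row A' hA'pd z gS hgSinj hgSz hgSsurj (fun p => v p.1)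
  have hpos := ghost_schur_pos A' hA'pd z gS hgSinj hgSz hgSsurj
  set s : ℝ := A' z z - ∑ p, ∑ q, A' z (gS p) * (A'.submatrix gS gS)⁻¹ p q * A' (gS q) z with hs
  -- identify the partial covariance with the left-hand side of the Schur identity
  have h2 : ∀ p : ↥S, G x p.1 = A' z (gS p) := fun p => by
    rw [hA', Matrix.submatrix_apply, hgS]
    exact hGA _ _ hxy (hS1 p).2
  have h3 : G.submatrix (Subtype.val : ↥S → Fin n) (Subtype.val : ↥S → Fin n)
      = A'.submatrix gS gS := by
    ext p q
    simp only [hA', Matrix.submatrix_apply, hgS]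
    exact hGA _ _ (hS1 p).2 (hS1 q).2
  have hrow' : v x - ∑ p : ↥S, ∑ q : ↥S, G x p.1
      * (G.submatrix (Subtype.val : ↥S → Fin n) (Subtype.val : ↥S → Fin n))⁻¹ p q * v q.1
      = s * (A'⁻¹.mulVec (fun p => v p.1)) z := by
    rw [h3]
    simpa only [h2, hgS] using hrow
  rw [hrow']
  refine mul_nonneg hpos.le ?_
  -- `(A'⁻¹ v')_z = κ (A'⁻¹ r')_z`: the four columns drop since they are `≠ x`
  have hA'A' : A'⁻¹ * A' = 1 :=
    Matrix.nonsing_inv_mul A' ((Matrix.isUnit_iff_isUnit_det A').mp hA'pd.isUnit)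
  have hcol : ∀ c : Fin n, c ≠ y → c ≠ x → ∑ p : ↥T, A'⁻¹ z p * A p.1 c = 0 := by
    intro c hcy hcx
    have hcT : c ∈ T := Finset.mem_erase.2 ⟨hcy, Finset.mem_univ _⟩
    have hzc : z ≠ ⟨c, hcT⟩ := fun h => hcx (congrArg Subtype.val h).symm
    have h := congrFun (congrFun hA'A' z) ⟨c, hcT⟩
    rw [Matrix.mul_apply, Matrix.one_apply_ne hzc] at h
    simpa only [hA', Matrix.submatrix_apply] using h
  have hfin : (A'⁻¹.mulVec (fun p => v p.1)) z = κ * (A'⁻¹.mulVec (fun p => r p.1)) z := by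
    simp only [Matrix.mulVec, dotProduct]
    have e : ∀ p : ↥T, A'⁻¹ z p * v p.1
        = (A'⁻¹ z p * A p.1 (w 0)) * b₀ + (A'⁻¹ z p * A p.1 (w 1)) * b₁
          + (A'⁻¹ z p * A p.1 (w 2)) * b₂ + (A'⁻¹ z p * A p.1 t) * b₃
          + κ * (A'⁻¹ z p * r p.1) := fun p => by
      rw [hv p.1 (hTy p)]
      ring
    simp only [e, Finset.sum_add_distrib, ← Finset.sum_mul, ← Finset.mul_sum,
      hcol (w 0) (hwy 0) (hwx 0), hcol (w 1) (hwy 1) (hwx 1), hcol (w 2) (hwy 2) (hwx 2),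
      hcol t hty htx, zero_mul, zero_add]
  rw [hfin]
  exact hsign

/-- Registered stub `stub_imNonadj_of_amputatedLebowitz` (tooth E1 of line `Sketch`): VP¹ for every
pair ferromagnet implies `(Σ⁻¹)_{xy} ≤ 0` for non-adjacent `x ≠ y` with `y` in at most three bonds
(the degree of `x` is arbitrary).  S1 reduces to `PCov(x,y|S) ≥ 0`; Callen at `y` writes the column
`y` of `Σ` as `v = ⟨tanh(h_y)σ_·⟩`, Walsh as `∑βⱼ Σ_{·wⱼ} + κ u` in the one-spin star–triangle
decimation `ν` of `y` (`e1_decimate`), `κ ≤ 0` (`c2_three`); the Schur core `e1_core` turns `PCov`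
into `s κ (N'⁻¹u')_x`, and `(N'⁻¹u')_x = (N⁻¹u)_x ≤ 0` (`e1_solve_free_row`) is VP¹ for `ν` at
`(x; w₀,w₁,w₂)`. [folklore] -/
theorem stub_imNonadj_of_amputatedLebowitz :
    (∀ (n m : ℕ) (K : Fin m → ℝ) (C : Fin m → Finset (Fin n)), (∀ i, 0 ≤ K i) → (∀ i, (C i).card = 2) →
      ∀ z x₂ x₃ x₄ : Fin n,
        0 ≤ ∑ a : Fin n,
          (Matrix.of fun (p q : Fin n) =>
              gksExpect Finset.univ K C (fun ω => spinAt p ω * spinAt q ω))⁻¹ z a *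
            (gksExpect Finset.univ K C (fun ω => spinAt a ω * spinAt x₂ ω) *
                gksExpect Finset.univ K C (fun ω => spinAt x₃ ω * spinAt x₄ ω) +
              gksExpect Finset.univ K C (fun ω => spinAt a ω * spinAt x₃ ω) *
                gksExpect Finset.univ K C (fun ω => spinAt x₂ ω * spinAt x₄ ω) +
              gksExpect Finset.univ K C (fun ω => spinAt a ω * spinAt x₄ ω) *
                gksExpect Finset.univ K C (fun ω => spinAt x₂ ω * spinAt x₃ ω) -
              gksExpect Finset.univ K C
                (fun ω => spinAt a ω * spinAt x₂ ω * spinAt x₃ ω * spinAt x₄ ω))) →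
    ∀ (n m : ℕ) (K : Fin m → ℝ) (C : Fin m → Finset (Fin n)), (∀ i, 0 ≤ K i) → (∀ i, (C i).card = 2) →
      ∀ x y : Fin n, x ≠ y → (∀ i, ¬ (x ∈ C i ∧ y ∈ C i)) →
        (Finset.univ.filter (fun i => y ∈ C i)).card ≤ 3 →
        (Matrix.of fun p q : Fin n => gksExpect Finset.univ K C (fun ω => spinAt p ω * spinAt q ω))⁻¹ x y ≤ 0 := by
  intro hVP n m K C hK hC x y hxy hnadj hdy
  -- the matrix `G = Σ_μ`, the set `S`, the Schur step S1
  obtain ⟨G, hG⟩ : ∃ G : Matrix (Fin n) (Fin n) ℝ, G = Matrix.of fun p q : Fin n =>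
      gksExpect Finset.univ K C (fun ω => spinAt p ω * spinAt q ω) := ⟨_, rfl⟩
  have hGe : ∀ p q, G p q = gksExpect Finset.univ K C (fun ω => spinAt p ω * spinAt q ω) :=
    fun p q => by rw [hG]; rfl
  rw [← hG]
  obtain ⟨S, hS⟩ : ∃ S : Finset (Fin n), S = (Finset.univ.erase x).erase y := ⟨_, rfl⟩
  have hS1 : ∀ p : ↥S, p.1 ≠ x ∧ p.1 ≠ y := fun p => by
    have h : p.1 ∈ (Finset.univ.erase x).erase y := by rw [← hS]; exact p.2
    rw [Finset.mem_erase, Finset.mem_erase] at h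
    exact ⟨h.2.1, h.1⟩
  have hPD : G.PosDef := by rw [hG]; exact schur_posDef n m K C
  have hxT : x ∈ Finset.univ.erase y := Finset.mem_erase.2 ⟨hxy, Finset.mem_univ _⟩
  refine stub_entry_nonpos_of_pcov n m K C hK hC G hG x y S hxy hS ?_
  have hGsymm : ∀ p q, G p q = G q p := fun p q => by
    rw [hGe, hGe]
    exact congrArg _ (funext fun ω => mul_comm _ _)
  -- case 1: `y` is free in `μ`
  by_cases hyfree : ∀ i, y ∉ C i
  · have hcoly : ∀ q, q ≠ y → G q y = 0 := fun q hq => by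
      rw [hGsymm, hGe]
      exact c2_free K C y (fun i hi => absurd hi (hyfree i)) (spinAt q)
        (fun ω => pcm2im_spinAt_flip_ne hq ω)
    rw [hcoly x hxy]
    have h0 : ∀ q : ↥S, G q.1 y = 0 := fun q => hcoly q.1 (hS1 q).2
    simp only [h0, mul_zero, Finset.sum_const_zero, sub_zero, le_refl]
  push Not at hyfree
  obtain ⟨i₀, hi₀⟩ := hyfree
  -- a site `d ∉ {x, y}`: the other endpoint of the bond `i₀` at `y`
  obtain ⟨d, hdx', hdy'⟩ : ∃ d : Fin n, d ≠ x ∧ d ≠ y := by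
    obtain ⟨p, hp, hpy⟩ := Finset.exists_mem_ne (s := C i₀) (by rw [hC i₀]; norm_num) y
    exact ⟨p, fun h => hnadj i₀ ⟨h ▸ hp, hi₀⟩, hpy⟩
  have hnadj' : ∀ i, ¬ (y ∈ C i ∧ x ∈ C i) := fun i h => hnadj i ⟨h.2, h.1⟩
  -- the local field at `y` and its Walsh / star–triangle forms
  obtain ⟨b, w, hb, hw, hHy⟩ := c2_site K C hK hC y x hnadj' hdy d ⟨hdy', hdx'⟩
  obtain ⟨βc, κ, cy, J, hκ, hJ, h3⟩ := c2_three b hb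
  have hwy : ∀ j, w j ≠ y := fun j => (hw j).1
  have hwx : ∀ j, w j ≠ x := fun j => (hw j).2
  obtain ⟨hy, hhy⟩ : ∃ hy : SpinConfig (Fin n) → ℝ, ∀ ω, hy ω = ∑ j, b j * spinAt (w j) ω :=
    ⟨_, fun _ => rfl⟩
  obtain ⟨Ky, hKyd⟩ : ∃ Ky : Fin m → ℝ, ∀ i, Ky i = if y ∈ C i then 0 else K i := ⟨_, fun _ => rfl⟩
  have hKyf : Ky = fun i => if y ∈ C i then 0 else K i := funext hKyd
  have hH : ∀ ω, gksHamiltonian Finset.univ K C ω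
      = gksHamiltonian Finset.univ Ky C ω + spinAt y ω * hy ω := fun ω => by
    rw [hhy, hKyf]; exact hHy K (fun _ _ => rfl) ω
  have hKy0 : ∀ i, y ∈ C i → Ky i = 0 := fun i hi => by rw [hKyd, if_pos hi]
  have hKynn : ∀ i, 0 ≤ Ky i := fun i => by
    rw [hKyd]; split_ifs; exacts [le_rfl, hK i]
  have hy_y : ∀ ω, hy (ω * Pi.mulSingle y (-1)) = hy ω := fun ω => by
    rw [hhy, hhy]; exact Finset.sum_congr rfl fun j _ => by rw [pcm2im_spinAt_flip_ne (hwy j)]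
  have hEy : ∀ F : SpinConfig (Fin n) → ℝ, (∀ ω, F (ω * Pi.mulSingle y (-1)) = F ω) →
      gksExpect Finset.univ K C (fun ω => spinAt y ω * F ω)
        = gksExpect Finset.univ K C (fun ω => Real.tanh (hy ω) * F ω) :=
    fun F hF => (c2_integrate Finset.univ K Ky C y hy hH (fun i _ => hKy0 i) hy_y F hF).1
  have tW : ∀ ω, Real.tanh (hy ω) = ∑ j, βc j * spinAt (w j) ω
      + κ * (spinAt (w 0) ω * spinAt (w 1) ω * spinAt (w 2) ω) := fun ω => by
    rw [hhy]
    exact (h3 (fun j => spinAt (w j) ω) (fun j => spinAt_eq_one_or_eq_neg_one _ _)).1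
  have cW : ∀ ω, Real.cosh (hy ω) = Real.exp cy * Real.exp (J 0 * (spinAt (w 1) ω * spinAt (w 2) ω)
      + J 1 * (spinAt (w 0) ω * spinAt (w 2) ω) + J 2 * (spinAt (w 0) ω * spinAt (w 1) ω)) := fun ω => by
    rw [hhy]
    exact (h3 (fun j => spinAt (w j) ω) (fun j => spinAt_eq_one_or_eq_neg_one _ _)).2
  -- the column `y` of `G`: `G_{qy} = v(q) = ⟨tanh(h_y) σ_q⟩` for `q ≠ y`
  obtain ⟨v, hv⟩ : ∃ v : Fin n → ℝ, ∀ q, v q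
      = gksExpect Finset.univ K C (fun ω => Real.tanh (hy ω) * spinAt q ω) := ⟨_, fun _ => rfl⟩
  have hGy : ∀ q, q ≠ y → G q y = v q := fun q hq => by
    rw [hGsymm, hGe, hv]
    exact hEy _ (fun ω => pcm2im_spinAt_flip_ne hq ω)
  have htanh_split : ∀ q, (fun ω => Real.tanh (hy ω) * spinAt q ω)
      = fun ω => (βc 0 * (spinAt q ω * spinAt (w 0) ω) + βc 1 * (spinAt q ω * spinAt (w 1) ω))
        + (βc 2 * (spinAt q ω * spinAt (w 2) ω)
          + κ * (spinAt q ω * spinAt (w 0) ω * spinAt (w 1) ω * spinAt (w 2) ω)) := fun q =>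
    funext fun ω => by rw [tW, Fin.sum_univ_three]; ring
  rw [hGy x hxy]
  have hGyS : ∀ q : ↥S, G q.1 y = v q.1 := fun q => hGy q.1 (hS1 q).2
  simp only [hGyS]
  by_cases hwd : w 0 ≠ w 1 ∧ w 0 ≠ w 2 ∧ w 1 ≠ w 2
  · -- case 2: non-degenerate cubic — the decimated system `ν`
    set Kν : Fin (m + 3) → ℝ := Fin.append Ky J with hKν
    set Cν : Fin (m + 3) → Finset (Fin n) := Fin.append C ![{w 1, w 2}, {w 0, w 2}, {w 0, w 1}]
      with hCν
    have hKν0 : ∀ i, 0 ≤ Kν i := by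
      intro i
      induction i using Fin.addCases with
      | left i => rw [hKν, Fin.append_left]; exact hKynn i
      | right j => rw [hKν, Fin.append_right]; exact hJ j
    have hCν2 : ∀ i, (Cν i).card = 2 := by
      intro i
      induction i using Fin.addCases with
      | left i => rw [hCν, Fin.append_left]; exact hC i
      | right j =>
          rw [hCν, Fin.append_right]
          fin_cases j <;>
            simp [Finset.card_pair hwd.1, Finset.card_pair hwd.2.1, Finset.card_pair hwd.2.2]
    have hyν : ∀ i, y ∈ Cν i → Kν i = 0 := by
      intro i
      induction i using Fin.addCases with
      | left i => rw [hCν, Fin.append_left, hKν, Fin.append_left]; exact hKy0 i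
      | right j =>
          rw [hCν, Fin.append_right]
          fin_cases j <;> simp [(hwy 0).symm, (hwy 1).symm, (hwy 2).symm]
    have hdec : ∀ F : SpinConfig (Fin n) → ℝ, (∀ ω, F (ω * Pi.mulSingle y (-1)) = F ω) →
        gksExpect Finset.univ K C F = gksExpect Finset.univ Kν Cν F :=
      e1_decimate K Ky C y hy cy J w hwd hH hKy0 hy_y cW
    set N : Matrix (Fin n) (Fin n) ℝ :=
      Matrix.of fun p q : Fin n => gksExpect Finset.univ Kν Cν (fun ω => spinAt p ω * spinAt q ω)
      with hN
    have hNe : ∀ p q, gksExpect Finset.univ Kν Cν (fun ω => spinAt p ω * spinAt q ω) = N p q :=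
      fun p q => rfl
    have hPDN : N.PosDef := schur_posDef n (m + 3) Kν Cν
    have hNfree : ∀ k, k ≠ y → N y k = 0 := fun k hk =>
      c2_free Kν Cν y hyν (spinAt k) (fun ω => pcm2im_spinAt_flip_ne hk ω)
    have hGN : ∀ p q, p ≠ y → q ≠ y → G p q = N p q := fun p q hp hq => by
      rw [hGe, ← hNe]
      exact hdec _ (fun ω => by rw [pcm2im_spinAt_flip_ne hp, pcm2im_spinAt_flip_ne hq])
    set u : Fin n → ℝ := fun a => gksExpect Finset.univ Kν Cν
      (fun ω => spinAt a ω * spinAt (w 0) ω * spinAt (w 1) ω * spinAt (w 2) ω) with hu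
    have hue : ∀ a, gksExpect Finset.univ Kν Cν
        (fun ω => spinAt a ω * spinAt (w 0) ω * spinAt (w 1) ω * spinAt (w 2) ω) = u a :=
      fun a => rfl
    have huy : u y = 0 := by
      have h1 : (fun ω => spinAt y ω * spinAt (w 0) ω * spinAt (w 1) ω * spinAt (w 2) ω)
          = fun ω => spinAt y ω * (spinAt (w 0) ω * spinAt (w 1) ω * spinAt (w 2) ω) :=
        funext fun ω => by ring
      rw [← hue, h1]
      exact c2_free Kν Cν y hyν _ (fun ω => by
        rw [pcm2im_spinAt_flip_ne (hwy 0), pcm2im_spinAt_flip_ne (hwy 1),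
          pcm2im_spinAt_flip_ne (hwy 2)])
    -- `v = β₀ N_{·w₀} + β₁ N_{·w₁} + β₂ N_{·w₂} + κ u` off `y`
    have hvN : ∀ a, a ≠ y → v a
        = βc 0 * N a (w 0) + βc 1 * N a (w 1) + βc 2 * N a (w 2) + 0 * N a (w 0) + κ * u a := by
      intro a ha
      rw [hv, hdec _ (fun ω => by rw [hy_y, pcm2im_spinAt_flip_ne ha]), htanh_split,
        pcm2im_gksExpect_add, pcm2im_gksExpect_add, pcm2im_gksExpect_add,
        pcm2im_gksExpect_const_mul, pcm2im_gksExpect_const_mul, pcm2im_gksExpect_const_mul,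
        pcm2im_gksExpect_const_mul]
      rw [hNe, hNe, hNe, hue]
      ring
    -- VP¹ for `ν` at `(x; w₀, w₁, w₂)`: `(N⁻¹u)_x ≤ 0`
    have hvp := hVP n (m + 3) Kν Cν hKν0 hCν2 x (w 0) (w 1) (w 2)
    rw [← hN] at hvp
    simp only [hNe, hue] at hvp
    have hNN : N⁻¹ * N = 1 :=
      Matrix.nonsing_inv_mul N ((Matrix.isUnit_iff_isUnit_det N).mp hPDN.isUnit)
    have hcol : ∀ c, x ≠ c → ∑ a, N⁻¹ x a * N a c = 0 := fun c hc => by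
      have h := congrFun (congrFun hNN x) c
      rwa [Matrix.mul_apply, Matrix.one_apply_ne hc] at h
    have hβx : (N⁻¹.mulVec u) x ≤ 0 := by
      have e : ∀ a, N⁻¹ x a * (N a (w 0) * N (w 1) (w 2) + N a (w 1) * N (w 0) (w 2)
          + N a (w 2) * N (w 0) (w 1) - u a)
          = (N⁻¹ x a * N a (w 0)) * N (w 1) (w 2) + (N⁻¹ x a * N a (w 1)) * N (w 0) (w 2)
            + (N⁻¹ x a * N a (w 2)) * N (w 0) (w 1) - N⁻¹ x a * u a := fun a => by ring
      simp only [e, Finset.sum_sub_distrib, Finset.sum_add_distrib, ← Finset.sum_mul,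
        hcol (w 0) (hwx 0).symm, hcol (w 1) (hwx 1).symm, hcol (w 2) (hwx 2).symm, zero_mul,
        add_zero, zero_sub, neg_nonneg] at hvp
      exact hvp
    have hbridge := e1_solve_free_row N hPDN y hNfree u huy ⟨x, hxT⟩
    refine e1_core N hPDN x y hxy hxT S hS G hGN v u w (w 0) hwy hwx (hwy 0) (hwx 0)
      (βc 0) (βc 1) (βc 2) 0 κ hvN ?_
    rw [← hbridge]
    exact mul_nonneg_of_nonpos_of_nonpos hκ hβx
  · -- case 3: degenerate cubic — `v` is a combination of columns of `G`, `PCov = 0`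
    obtain ⟨j₀, hj₀⟩ := c2_cube_degen w hwd
    have hvG : ∀ a, a ≠ y → v a
        = βc 0 * G a (w 0) + βc 1 * G a (w 1) + βc 2 * G a (w 2) + κ * G a (w j₀)
          + 0 * (0 : Fin n → ℝ) a := by
      intro a _
      have h1 : (fun ω => spinAt a ω * spinAt (w 0) ω * spinAt (w 1) ω * spinAt (w 2) ω)
          = fun ω => spinAt a ω * spinAt (w j₀) ω := funext fun ω => by
        rw [mul_assoc, mul_assoc, ← mul_assoc (spinAt (w 0) ω), hj₀]
      rw [hv, htanh_split, pcm2im_gksExpect_add, pcm2im_gksExpect_add, pcm2im_gksExpect_add,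
        pcm2im_gksExpect_const_mul, pcm2im_gksExpect_const_mul, pcm2im_gksExpect_const_mul,
        pcm2im_gksExpect_const_mul, h1, ← hGe, ← hGe, ← hGe, ← hGe]
      ring
    exact e1_core G hPD x y hxy hxT S hS G (fun _ _ _ _ => rfl) v 0 w (w j₀) hwy hwx (hwy j₀)
      (hwx j₀) (βc 0) (βc 1) (βc 2) κ 0 hvG (by rw [zero_mul])

/-- Registered sub-goal `stub_inverseM_of_amputatedLebowitz` (tooth of line `Sketch`): VP¹ for every
pair ferromagnet implies the crux `PrecisionLaplacian.InverseMFerromagnet` (stmt-CriticalPhenomena-4798):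
E1 (`stub_imNonadj_of_amputatedLebowitz`) feeds the landed bridges of the 4798 chain — C3
`stub_row_deg_le_two`, C4 `stub_imDeg3_of_nonadj`, C5 `stub_im_of_imDeg3`. [folklore] -/
theorem stub_inverseM_of_amputatedLebowitz :
    (∀ (n m : ℕ) (K : Fin m → ℝ) (C : Fin m → Finset (Fin n)), (∀ i, 0 ≤ K i) → (∀ i, (C i).card = 2) →
      ∀ z x₂ x₃ x₄ : Fin n,
        0 ≤ ∑ a : Fin n,
          (Matrix.of fun (p q : Fin n) =>
              gksExpect Finset.univ K C (fun ω => spinAt p ω * spinAt q ω))⁻¹ z a *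
            (gksExpect Finset.univ K C (fun ω => spinAt a ω * spinAt x₂ ω) *
                gksExpect Finset.univ K C (fun ω => spinAt x₃ ω * spinAt x₄ ω) +
              gksExpect Finset.univ K C (fun ω => spinAt a ω * spinAt x₃ ω) *
                gksExpect Finset.univ K C (fun ω => spinAt x₂ ω * spinAt x₄ ω) +
              gksExpect Finset.univ K C (fun ω => spinAt a ω * spinAt x₄ ω) *
                gksExpect Finset.univ K C (fun ω => spinAt x₂ ω * spinAt x₃ ω) -
              gksExpect Finset.univ K C
                (fun ω => spinAt a ω * spinAt x₂ ω * spinAt x₃ ω * spinAt x₄ ω))) →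
    Summit.CriticalPhenomena.Ising3DConformalLimit.Theses.PrecisionLaplacian.InverseMFerromagnet :=
  fun hVP => stub_im_of_imDeg3 (stub_imDeg3_of_nonadj
    (fun n m K C hK hC x y hxy hnadj _ hdy =>
      stub_imNonadj_of_amputatedLebowitz hVP n m K C hK hC x y hxy hnadj hdy)
    stub_row_deg_le_two)

end Summit.CriticalPhenomena.Ising3DConformalLimit.PrecisionLaplacianMoebiusLimitOfTwoPointLaw
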